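import Literature.NumberTheory.Sieve.LinearPairMoebiusWindow

/-!
# Balanced pair window, generic weights — III: the sawtooth sums (soloist file, project (F)-kernel, L3)

Soloist file (informed mode).  The Erdős–Turán + Duke–Friedlander–Iwaniec bound for the sawtooth sums
of the balanced divisor window of a pair of linear congruences, for a general product weight
`w₀(d₀) w₁(d₁)` with `|wᵢ(d)| ≤ log Bᵢ` on `d ≤ Bᵢ` and `w₁` squarefree-supported
(`LinearPairMoebius.abs_psi_le` is the case `wᵢ = μ log`):
`|Σ W(d) ψ((y − ν_d)/lcm(d₀,d₁))| ≤ (48400 K_w + 144)(log x)⁶ x^{1−c}`.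
The twin weight `μ(d₀)μ(d₁) log²(d₀d₁)` is a combination of three such products after the
rescalings `(μ log²/log B) ⊗ (μ · log B)`, `μ log ⊗ μ log`, `(μ · log B) ⊗ (μ log²/log B)`. [folklore]
-/

namespace Summit.Parity.BatemanHorn.Theorems.PairWindow

open scoped BigOperators ArithmeticFunction.Moebius FourierTransform
open Finset Real Filter Asymptotics
open Literature.NumberTheory.Sieve Literature.NumberTheory.Sieve.LinearPairMoebius
open Literature.NumberTheory.LFunctions.AFE (saw)

/-- **The sawtooth sums of the balanced window.**  Let `Kw, ε` be such that the exponential-sum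
bound of `LinearPairKloosterman.norm_windowSum_le` holds with constant `Kw` and exponent
`η + 7(1+θ)/8 + (1+θ−σ)(11/48+ε)`, let `0 < c ≤ min(σ/2, 1/2)`, `0 < θ, η ≤ c` with
`η + 7(1+θ)/8 + (1+θ−σ)(11/48+ε) + (11/4)c ≤ 1 − c`, and let `x ≥ 6`, `|a₀| ≤ x`, `2D ≤ x^σ`,
`x^{1−σ/2} ≤ Bᵢ ≤ x²`, `y ≤ x`.  Then for the window weight
`W(d) = [Sol(d)][x^{1−η} < d₀d₁ ≤ x^{1+θ}][x^σ < dᵢ] w₀(d₀) w₁(d₁)` with real weights `|wᵢ(d)| ≤ log Bᵢ`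
on `d ≤ Bᵢ`, `w₁` supported on squarefree numbers, and any solution map `ν`,
`|Σ_{d₀ ≤ B₀, d₁ ≤ B₁} W(d) ψ((y − ν_d)/lcm(d₀,d₁))| ≤ (48400 Kw + 144) (log x)^6 x^{1−c}`
(Erdős–Turán with `V = ⌊x^{2c}⌋`, Duke–Friedlander–Iwaniec for `0 < |k| ≤ 5(2V+1)`, and the mass
bound for `k = 0`); verbatim the Literature proof of `LinearPairMoebius.abs_psi_le` (weight
`μ log ⊗ μ log`) for general weights. [folklore] -/
theorem abs_psi_le_gen {q₀ q₁ : ℕ} {a₀ a₁ : ℤ} {ε Kw : ℝ} (hKw0 : 0 ≤ Kw)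
    (hKw : ∀ (σ θ η : ℝ) (x : ℕ), 0 < σ → 0 < θ → θ ≤ σ → θ ≤ 1 → 0 < η → η ≤ 1 →
      6 ≤ x → |(a₀ : ℝ)| ≤ x →
      2 * ((((q₁ : ℤ) * a₀ - (q₀ : ℤ) * a₁).natAbs : ℕ) : ℝ) ≤ (x : ℝ) ^ σ →
      ∀ (X₀ X₁ : ℕ), (x : ℝ) ^ (1 + θ - σ) ≤ X₀ → (x : ℝ) ^ (1 + θ - σ) ≤ X₁ →
      ∀ (k : ℤ), k ≠ 0 → ∀ (y : ℝ), |y| ≤ x →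
      ∀ (G₀ G₁ : ℝ), 0 ≤ G₀ → 0 ≤ G₁ → ∀ (v₀ v₁ : ℕ → ℂ), (∀ d, ‖v₀ d‖ ≤ G₀) →
      (∀ d, ‖v₁ d‖ ≤ G₁) → (∀ d, v₁ d ≠ 0 → Squarefree d) →
      ∀ (ν : ℕ → ℕ → ℕ), (∀ d₀ d₁ : ℕ, 0 < d₀ → 0 < d₁ → Nat.Coprime d₀ q₀ → Nat.Coprime d₁ q₁ →
        ((Nat.gcd d₀ d₁ : ℕ) : ℤ) ∣ (q₁ : ℤ) * a₀ - (q₀ : ℤ) * a₁ →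
          (d₀ : ℤ) ∣ (q₀ : ℤ) * (ν d₀ d₁) + a₀ ∧ (d₁ : ℤ) ∣ (q₁ : ℤ) * (ν d₀ d₁) + a₁) →
      ‖∑ d₀ ∈ Icc 1 X₀, ∑ d₁ ∈ Icc 1 X₁,
          (if ((Nat.Coprime d₀ q₀ ∧ Nat.Coprime d₁ q₁ ∧
                ((Nat.gcd d₀ d₁ : ℕ) : ℤ) ∣ (q₁ : ℤ) * a₀ - (q₀ : ℤ) * a₁) ∧
              ((x : ℝ) ^ (1 - η) < (d₀ : ℝ) * d₁ ∧ (d₀ : ℝ) * d₁ ≤ (x : ℝ) ^ (1 + θ) ∧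
                (x : ℝ) ^ σ < (d₀ : ℝ) ∧ (x : ℝ) ^ σ < (d₁ : ℝ))) then
            v₀ d₀ * v₁ d₁ * Complex.exp (2 * π * Complex.I *
              (((k : ℝ) * ((y - (ν d₀ d₁ : ℝ)) / ((Nat.lcm d₀ d₁ : ℕ) : ℝ)) : ℝ) : ℂ))
          else 0)‖ ≤
        Kw * G₀ * G₁ * |(k : ℝ)| ^ (11 / 8 : ℝ) *
          (x : ℝ) ^ (η + (1 + θ) * (7 / 8) + (1 + θ - σ) * (11 / 48 + ε)) * Real.log x ^ 3)
    {σ θ η c : ℝ} (hσ : 0 < σ) (hσ1 : σ ≤ 1) (hc : 0 < c) (hcσ : c ≤ σ / 2) (hc2 : c ≤ 1 / 2)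
    (hθ : 0 < θ) (hθc : θ ≤ c) (hη : 0 < η) (hηc : η ≤ c)
    (hexp : η + (1 + θ) * (7 / 8) + (1 + θ - σ) * (11 / 48 + ε) + (11 / 4) * c ≤ 1 - c)
    {x : ℕ} (hx : 6 ≤ x) (ha₀ : |(a₀ : ℝ)| ≤ x)
    (h2D : 2 * ((((q₁ : ℤ) * a₀ - (q₀ : ℤ) * a₁).natAbs : ℕ) : ℝ) ≤ (x : ℝ) ^ σ)
    {B₀ B₁ : ℕ} (hB₀ : (x : ℝ) ^ (1 - σ / 2) ≤ B₀) (hB₀' : (B₀ : ℝ) ≤ (x : ℝ) ^ 2)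
    (hB₁ : (x : ℝ) ^ (1 - σ / 2) ≤ B₁) (hB₁' : (B₁ : ℝ) ≤ (x : ℝ) ^ 2)
    (ν : ℕ → ℕ → ℕ)
    (hν : ∀ d₀ d₁ : ℕ, 0 < d₀ → 0 < d₁ → Nat.Coprime d₀ q₀ → Nat.Coprime d₁ q₁ →
      ((Nat.gcd d₀ d₁ : ℕ) : ℤ) ∣ (q₁ : ℤ) * a₀ - (q₀ : ℤ) * a₁ →
        (d₀ : ℤ) ∣ (q₀ : ℤ) * (ν d₀ d₁) + a₀ ∧ (d₁ : ℤ) ∣ (q₁ : ℤ) * (ν d₀ d₁) + a₁)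
    {w₀ w₁ : ℕ → ℝ} (hw₀ : ∀ d, d ≤ B₀ → |w₀ d| ≤ Real.log B₀)
    (hw₁ : ∀ d, d ≤ B₁ → |w₁ d| ≤ Real.log B₁) (hw₁s : ∀ d, w₁ d ≠ 0 → Squarefree d)
    {y : ℕ} (hy : y ≤ x) :
    |∑ d₀ ∈ Icc 1 B₀, ∑ d₁ ∈ Icc 1 B₁,
        (if (Nat.Coprime d₀ q₀ ∧ Nat.Coprime d₁ q₁ ∧
            ((Nat.gcd d₀ d₁ : ℕ) : ℤ) ∣ (q₁ : ℤ) * a₀ - (q₀ : ℤ) * a₁) then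
          (if ((x : ℝ) ^ (1 - η) < (d₀ : ℝ) * d₁ ∧ (d₀ : ℝ) * d₁ ≤ (x : ℝ) ^ (1 + θ) ∧
              (x : ℝ) ^ σ < (d₀ : ℝ) ∧ (x : ℝ) ^ σ < (d₁ : ℝ)) then
            w₀ d₀ * w₁ d₁ else 0) else 0) *
          saw (((y : ℝ) - ν d₀ d₁) / (Nat.lcm d₀ d₁ : ℕ))| ≤
      (48400 * Kw + 144) * Real.log x ^ 6 * (x : ℝ) ^ (1 - c) := by
  classical
  -- sizes
  have hx1N : 1 ≤ x := le_trans (by norm_num) hx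
  have hx6 : (6 : ℝ) ≤ x := by exact_mod_cast hx
  have hx0 : (0 : ℝ) < x := by linarith
  have hx1 : (1 : ℝ) ≤ x := by linarith
  have hL1 : 1 ≤ Real.log x := by
    rw [Real.le_log_iff_exp_le hx0]
    have := Real.exp_one_lt_d9; linarith
  have hL0 : 0 ≤ Real.log x := by linarith
  have hxσ2 : (1 : ℝ) ≤ (x : ℝ) ^ (1 - σ / 2) := Real.one_le_rpow hx1 (by linarith)
  have hB₀1 : 1 ≤ B₀ := by
    have : (1 : ℝ) ≤ B₀ := hxσ2.trans hB₀
    exact_mod_cast this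
  have hB₁1 : 1 ≤ B₁ := by
    have : (1 : ℝ) ≤ B₁ := hxσ2.trans hB₁
    exact_mod_cast this
  have hlogx2 : Real.log ((x : ℝ) ^ 2) = 2 * Real.log x := by
    rw [show ((x : ℝ) ^ 2) = (x : ℝ) ^ (2 : ℝ) by norm_cast, Real.log_rpow hx0]
  have hlogB₀ : Real.log B₀ ≤ 2 * Real.log x := by
    rw [← hlogx2]; exact Real.log_le_log (by exact_mod_cast hB₀1) hB₀'
  have hlogB₁ : Real.log B₁ ≤ 2 * Real.log x := by
    rw [← hlogx2]; exact Real.log_le_log (by exact_mod_cast hB₁1) hB₁'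
  have hXB : (x : ℝ) ^ (1 + θ - σ) ≤ (x : ℝ) ^ (1 - σ / 2) :=
    Real.rpow_le_rpow_of_exponent_le hx1 (by linarith)
  have hXB₀ : (x : ℝ) ^ (1 + θ - σ) ≤ B₀ := hXB.trans hB₀
  have hXB₁ : (x : ℝ) ^ (1 + θ - σ) ≤ B₁ := hXB.trans hB₁
  have hyx : |((y : ℕ) : ℝ)| ≤ x := by
    rw [abs_of_nonneg (Nat.cast_nonneg y)]; exact_mod_cast hy
  -- `V = ⌊x^{2c}⌋`
  obtain ⟨hV1, hV2, hV3, hV4, hV5⟩ := floor_rpow_facts hx1N hc.le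
  obtain ⟨hlogV, hlog2V⟩ := log_floor_rpow_le hx hc.le hc2
  have hV0 : (0 : ℝ) < 2 * (⌊(x : ℝ) ^ (2 * c)⌋₊ : ℝ) + 1 := by positivity
  -- the exponent
  have hxe : (x : ℝ) ^ ((11 / 4) * c) *
      (x : ℝ) ^ (η + (1 + θ) * (7 / 8) + (1 + θ - σ) * (11 / 48 + ε)) ≤ (x : ℝ) ^ (1 - c) := by
    rw [← Real.rpow_add hx0]
    exact Real.rpow_le_rpow_of_exponent_le hx1 (by linarith)
  -- the uniform exponential-sum bound `E`
  set E : ℝ := 400 * Kw * Real.log x ^ 5 * (x : ℝ) ^ (1 - c) with hEdef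
  have hE0 : 0 ≤ E := by rw [hEdef]; positivity
  -- truncated weights
  set v₀ : ℕ → ℂ := fun d => if d ≤ B₀ then ((w₀ d : ℝ) : ℂ) else 0 with hv₀
  set v₁ : ℕ → ℂ := fun d => if d ≤ B₁ then ((w₁ d : ℝ) : ℂ) else 0 with hv₁
  set u₀ : ℕ → ℂ := fun d => if d ≤ B₀ then ((|w₀ d| : ℝ) : ℂ) else 0 with hu₀
  set u₁ : ℕ → ℂ := fun d => if d ≤ B₁ then ((|w₁ d| : ℝ) : ℂ) else 0 with hu₁
  have htrunc : ∀ (w : ℕ → ℝ) (B : ℕ) (L : ℝ), 0 ≤ L → (∀ d, d ≤ B → |w d| ≤ L) → ∀ d,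
      ‖(if d ≤ B then ((w d : ℝ) : ℂ) else 0)‖ ≤ L ∧
        ‖(if d ≤ B then ((|w d| : ℝ) : ℂ) else 0)‖ ≤ L := by
    intro w B L hL hw d
    by_cases hd : d ≤ B
    · rw [if_pos hd, if_pos hd, Complex.norm_real, Complex.norm_real, Real.norm_eq_abs,
        Real.norm_eq_abs, abs_abs]
      exact ⟨hw d hd, hw d hd⟩
    · rw [if_neg hd, if_neg hd, norm_zero]
      exact ⟨hL, hL⟩
  have hw₀' : ∀ d, d ≤ B₀ → |w₀ d| ≤ 2 * Real.log x := fun d hd => (hw₀ d hd).trans hlogB₀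
  have hw₁' : ∀ d, d ≤ B₁ → |w₁ d| ≤ 2 * Real.log x := fun d hd => (hw₁ d hd).trans hlogB₁
  have hv₀b : ∀ d, ‖v₀ d‖ ≤ 2 * Real.log x := fun d =>
    (htrunc w₀ B₀ _ (by positivity) hw₀' d).1
  have hv₁b : ∀ d, ‖v₁ d‖ ≤ 2 * Real.log x := fun d =>
    (htrunc w₁ B₁ _ (by positivity) hw₁' d).1
  have hu₀b : ∀ d, ‖u₀ d‖ ≤ 2 * Real.log x := fun d =>
    (htrunc w₀ B₀ _ (by positivity) hw₀' d).2
  have hu₁b : ∀ d, ‖u₁ d‖ ≤ 2 * Real.log x := fun d =>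
    (htrunc w₁ B₁ _ (by positivity) hw₁' d).2
  have hv₁s : ∀ d, v₁ d ≠ 0 → Squarefree d := by
    intro d hd
    by_cases hdB : d ≤ B₁
    · refine hw₁s d fun h0 => hd ?_
      rw [hv₁]; simp only [if_pos hdB, h0, Complex.ofReal_zero]
    · exact absurd (by rw [hv₁]; simp only [if_neg hdB]) hd
  have hu₁s : ∀ d, u₁ d ≠ 0 → Squarefree d := by
    intro d hd
    by_cases hdB : d ≤ B₁
    · refine hw₁s d fun h0 => hd ?_
      rw [hu₁]; simp only [if_pos hdB, h0, abs_zero, Complex.ofReal_zero]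
    · exact absurd (by rw [hu₁]; simp only [if_neg hdB]) hd
  -- the common final step of the two exponential-sum bounds
  have hfin : ∀ κ : ℝ, |κ| ≤ 20 * (x : ℝ) ^ (2 * c) →
      Kw * (2 * Real.log x) * (2 * Real.log x) * |κ| ^ (11 / 8 : ℝ) *
        (x : ℝ) ^ (η + (1 + θ) * (7 / 8) + (1 + θ - σ) * (11 / 48 + ε)) * Real.log x ^ 3 ≤ E := by
    intro κ hκ
    have hk := abs_rpow_le_of_le hx1N hκ
    calc Kw * (2 * Real.log x) * (2 * Real.log x) * |κ| ^ (11 / 8 : ℝ) *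
          (x : ℝ) ^ (η + (1 + θ) * (7 / 8) + (1 + θ - σ) * (11 / 48 + ε)) * Real.log x ^ 3
        ≤ Kw * (2 * Real.log x) * (2 * Real.log x) * (100 * (x : ℝ) ^ ((11 / 4) * c)) *
          (x : ℝ) ^ (η + (1 + θ) * (7 / 8) + (1 + θ - σ) * (11 / 48 + ε)) * Real.log x ^ 3 := by
          gcongr
      _ = 400 * Kw * Real.log x ^ 5 * ((x : ℝ) ^ ((11 / 4) * c) *
          (x : ℝ) ^ (η + (1 + θ) * (7 / 8) + (1 + θ - σ) * (11 / 48 + ε))) := by ring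
      _ ≤ E := by rw [hEdef]; gcongr
  -- apply the packaged Erdős–Turán inequality
  refine (abs_sum_saw_le_of_bounds₂ (E := E) (M₀ := 12 * Real.log x ^ 3 * (x : ℝ) ^ (1 + θ))
    (Icc 1 B₀) (Icc 1 B₁)
    (fun d₀ d₁ => (if (Nat.Coprime d₀ q₀ ∧ Nat.Coprime d₁ q₁ ∧
        ((Nat.gcd d₀ d₁ : ℕ) : ℤ) ∣ (q₁ : ℤ) * a₀ - (q₀ : ℤ) * a₁) then
      (if ((x : ℝ) ^ (1 - η) < (d₀ : ℝ) * d₁ ∧ (d₀ : ℝ) * d₁ ≤ (x : ℝ) ^ (1 + θ) ∧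
          (x : ℝ) ^ σ < (d₀ : ℝ) ∧ (x : ℝ) ^ σ < (d₁ : ℝ)) then
        w₀ d₀ * w₁ d₁ else 0) else 0))
    (fun d₀ d₁ => ((y : ℝ) - ν d₀ d₁) / (Nat.lcm d₀ d₁ : ℕ)) hV1 hE0 ?_ ?_ ?_).trans ?_
  · -- `1 ≤ κ ≤ V`
    intro κ hκ1 hκV
    have hconv : ∀ d₀ ∈ Icc 1 B₀, ∀ d₁ ∈ Icc 1 B₁,
        (((if (Nat.Coprime d₀ q₀ ∧ Nat.Coprime d₁ q₁ ∧
            ((Nat.gcd d₀ d₁ : ℕ) : ℤ) ∣ (q₁ : ℤ) * a₀ - (q₀ : ℤ) * a₁) then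
          (if ((x : ℝ) ^ (1 - η) < (d₀ : ℝ) * d₁ ∧ (d₀ : ℝ) * d₁ ≤ (x : ℝ) ^ (1 + θ) ∧
              (x : ℝ) ^ σ < (d₀ : ℝ) ∧ (x : ℝ) ^ σ < (d₁ : ℝ)) then
            w₀ d₀ * w₁ d₁ else 0) else 0 : ℝ) : ℂ) *
          (𝐞 ((κ : ℝ) * (((y : ℝ) - ν d₀ d₁) / (Nat.lcm d₀ d₁ : ℕ))) : ℂ)) =
        (if ((Nat.Coprime d₀ q₀ ∧ Nat.Coprime d₁ q₁ ∧
              ((Nat.gcd d₀ d₁ : ℕ) : ℤ) ∣ (q₁ : ℤ) * a₀ - (q₀ : ℤ) * a₁) ∧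
            ((x : ℝ) ^ (1 - η) < (d₀ : ℝ) * d₁ ∧ (d₀ : ℝ) * d₁ ≤ (x : ℝ) ^ (1 + θ) ∧
              (x : ℝ) ^ σ < (d₀ : ℝ) ∧ (x : ℝ) ^ σ < (d₁ : ℝ))) then
          v₀ d₀ * v₁ d₁ * Complex.exp (2 * π * Complex.I *
            ((((κ : ℤ) : ℝ) * ((((y : ℕ) : ℝ) - (ν d₀ d₁ : ℝ)) / ((Nat.lcm d₀ d₁ : ℕ) : ℝ)) : ℝ) : ℂ))
        else 0) := by
      intro d₀ hd₀ d₁ hd₁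
      have h0 : d₀ ≤ B₀ := (Finset.mem_Icc.1 hd₀).2
      have h1 : d₁ ≤ B₁ := (Finset.mem_Icc.1 hd₁).2
      simp only [hv₀, hv₁, if_pos h0, if_pos h1, Int.cast_natCast]
      by_cases hs : (Nat.Coprime d₀ q₀ ∧ Nat.Coprime d₁ q₁ ∧
          ((Nat.gcd d₀ d₁ : ℕ) : ℤ) ∣ (q₁ : ℤ) * a₀ - (q₀ : ℤ) * a₁)
      · by_cases hw : ((x : ℝ) ^ (1 - η) < (d₀ : ℝ) * d₁ ∧ (d₀ : ℝ) * d₁ ≤ (x : ℝ) ^ (1 + θ) ∧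
            (x : ℝ) ^ σ < (d₀ : ℝ) ∧ (x : ℝ) ^ σ < (d₁ : ℝ))
        · rw [if_pos hs, if_pos hw, if_pos ⟨hs, hw⟩, fourierChar_coe_eq_exp]
          push_cast; ring
        · rw [if_pos hs, if_neg hw, if_neg (fun h => hw h.2)]; simp
      · rw [if_neg hs, if_neg (fun h => hs h.1)]; simp
    rw [Finset.sum_congr rfl fun d₀ hd₀ => Finset.sum_congr rfl fun d₁ hd₁ => hconv d₀ hd₀ d₁ hd₁]
    have hκ0 : ((κ : ℤ)) ≠ 0 := by exact_mod_cast (show κ ≠ 0 by omega)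
    have h := hKw σ θ η x hσ hθ (hθc.trans (by linarith)) (by linarith) hη (by linarith) hx ha₀ h2D
      B₀ B₁ hXB₀ hXB₁ (κ : ℤ) hκ0 ((y : ℕ) : ℝ) hyx (2 * Real.log x) (2 * Real.log x)
      (by positivity) (by positivity) v₀ v₁ hv₀b hv₁b hv₁s ν hν
    refine h.trans ?_
    have hκR : |(((κ : ℤ)) : ℝ)| ≤ 20 * (x : ℝ) ^ (2 * c) := by
      rw [Int.cast_natCast, abs_of_nonneg (Nat.cast_nonneg κ)]
      have : (κ : ℝ) ≤ ⌊(x : ℝ) ^ (2 * c)⌋₊ := by exact_mod_cast hκV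
      linarith
    exact hfin _ hκR
  · -- `0 < |κ| ≤ 5(2V+1)`, absolute values of the weights
    intro κ hκ0 hκH
    have hconv : ∀ d₀ ∈ Icc 1 B₀, ∀ d₁ ∈ Icc 1 B₁,
        (((|(if (Nat.Coprime d₀ q₀ ∧ Nat.Coprime d₁ q₁ ∧
            ((Nat.gcd d₀ d₁ : ℕ) : ℤ) ∣ (q₁ : ℤ) * a₀ - (q₀ : ℤ) * a₁) then
          (if ((x : ℝ) ^ (1 - η) < (d₀ : ℝ) * d₁ ∧ (d₀ : ℝ) * d₁ ≤ (x : ℝ) ^ (1 + θ) ∧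
              (x : ℝ) ^ σ < (d₀ : ℝ) ∧ (x : ℝ) ^ σ < (d₁ : ℝ)) then
            w₀ d₀ * w₁ d₁ else 0) else 0 : ℝ)| : ℝ) : ℂ) *
          (𝐞 ((κ : ℝ) * (((y : ℝ) - ν d₀ d₁) / (Nat.lcm d₀ d₁ : ℕ))) : ℂ)) =
        (if ((Nat.Coprime d₀ q₀ ∧ Nat.Coprime d₁ q₁ ∧
              ((Nat.gcd d₀ d₁ : ℕ) : ℤ) ∣ (q₁ : ℤ) * a₀ - (q₀ : ℤ) * a₁) ∧
            ((x : ℝ) ^ (1 - η) < (d₀ : ℝ) * d₁ ∧ (d₀ : ℝ) * d₁ ≤ (x : ℝ) ^ (1 + θ) ∧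
              (x : ℝ) ^ σ < (d₀ : ℝ) ∧ (x : ℝ) ^ σ < (d₁ : ℝ))) then
          u₀ d₀ * u₁ d₁ * Complex.exp (2 * π * Complex.I *
            ((((κ : ℤ) : ℝ) * ((((y : ℕ) : ℝ) - (ν d₀ d₁ : ℝ)) / ((Nat.lcm d₀ d₁ : ℕ) : ℝ)) : ℝ) : ℂ))
        else 0) := by
      intro d₀ hd₀ d₁ hd₁
      have h0 : d₀ ≤ B₀ := (Finset.mem_Icc.1 hd₀).2
      have h1 : d₁ ≤ B₁ := (Finset.mem_Icc.1 hd₁).2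
      simp only [hu₀, hu₁, if_pos h0, if_pos h1]
      by_cases hs : (Nat.Coprime d₀ q₀ ∧ Nat.Coprime d₁ q₁ ∧
          ((Nat.gcd d₀ d₁ : ℕ) : ℤ) ∣ (q₁ : ℤ) * a₀ - (q₀ : ℤ) * a₁)
      · by_cases hw : ((x : ℝ) ^ (1 - η) < (d₀ : ℝ) * d₁ ∧ (d₀ : ℝ) * d₁ ≤ (x : ℝ) ^ (1 + θ) ∧
            (x : ℝ) ^ σ < (d₀ : ℝ) ∧ (x : ℝ) ^ σ < (d₁ : ℝ))
        · rw [if_pos hs, if_pos hw, if_pos ⟨hs, hw⟩, fourierChar_coe_eq_exp, abs_mul]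
          push_cast; ring
        · rw [if_pos hs, if_neg hw, if_neg (fun h => hw h.2)]; simp
      · rw [if_neg hs, if_neg (fun h => hs h.1)]; simp
    rw [Finset.sum_congr rfl fun d₀ hd₀ => Finset.sum_congr rfl fun d₁ hd₁ => hconv d₀ hd₀ d₁ hd₁]
    have h := hKw σ θ η x hσ hθ (hθc.trans (by linarith)) (by linarith) hη (by linarith) hx ha₀ h2D
      B₀ B₁ hXB₀ hXB₁ κ hκ0 ((y : ℕ) : ℝ) hyx (2 * Real.log x) (2 * Real.log x)
      (by positivity) (by positivity) u₀ u₁ hu₀b hu₁b hu₁s ν hν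
    refine h.trans ?_
    have hκR : |((κ : ℤ) : ℝ)| ≤ 20 * (x : ℝ) ^ (2 * c) := by
      have : ((|κ| : ℤ) : ℝ) ≤ ((5 * (2 * ⌊(x : ℝ) ^ (2 * c)⌋₊ + 1) : ℕ) : ℝ) := by
        exact_mod_cast hκH
      rw [Int.cast_abs] at this
      exact this.trans hV5
    exact hfin _ hκR
  · -- the mass of the weights
    have hm := sum_abs_window_weight_le hB₀1 hB₁1 (Y' := (x : ℝ) ^ (1 - η)) (Z := (x : ℝ) ^ σ)
      (Real.one_le_rpow hx1 (by linarith : 0 ≤ 1 + θ))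
      (fun d₀ d₁ => (Nat.Coprime d₀ q₀ ∧ Nat.Coprime d₁ q₁ ∧
        ((Nat.gcd d₀ d₁ : ℕ) : ℤ) ∣ (q₁ : ℤ) * a₀ - (q₀ : ℤ) * a₁))
      w₀ w₁ (fun d _ hdB => hw₀ d hdB) (fun d _ hdB => hw₁ d hdB)
    have hconv : ∀ d₀ ∈ Icc 1 B₀, ∀ d₁ ∈ Icc 1 B₁,
        |(if (Nat.Coprime d₀ q₀ ∧ Nat.Coprime d₁ q₁ ∧
            ((Nat.gcd d₀ d₁ : ℕ) : ℤ) ∣ (q₁ : ℤ) * a₀ - (q₀ : ℤ) * a₁) then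
          (if ((x : ℝ) ^ (1 - η) < (d₀ : ℝ) * d₁ ∧ (d₀ : ℝ) * d₁ ≤ (x : ℝ) ^ (1 + θ) ∧
              (x : ℝ) ^ σ < (d₀ : ℝ) ∧ (x : ℝ) ^ σ < (d₁ : ℝ)) then
            w₀ d₀ * w₁ d₁ else 0) else 0 : ℝ)| =
        |(if ((Nat.Coprime d₀ q₀ ∧ Nat.Coprime d₁ q₁ ∧
              ((Nat.gcd d₀ d₁ : ℕ) : ℤ) ∣ (q₁ : ℤ) * a₀ - (q₀ : ℤ) * a₁) ∧
            ((x : ℝ) ^ (1 - η) < (d₀ : ℝ) * d₁ ∧ (d₀ : ℝ) * d₁ ≤ (x : ℝ) ^ (1 + θ) ∧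
              (x : ℝ) ^ σ < (d₀ : ℝ) ∧ (x : ℝ) ^ σ < (d₁ : ℝ))) then
          w₀ d₀ * w₁ d₁ else 0 : ℝ)| := by
      intro d₀ _ d₁ _
      by_cases hs : (Nat.Coprime d₀ q₀ ∧ Nat.Coprime d₁ q₁ ∧
          ((Nat.gcd d₀ d₁ : ℕ) : ℤ) ∣ (q₁ : ℤ) * a₀ - (q₀ : ℤ) * a₁)
      · by_cases hw : ((x : ℝ) ^ (1 - η) < (d₀ : ℝ) * d₁ ∧ (d₀ : ℝ) * d₁ ≤ (x : ℝ) ^ (1 + θ) ∧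
            (x : ℝ) ^ σ < (d₀ : ℝ) ∧ (x : ℝ) ^ σ < (d₁ : ℝ))
        · rw [if_pos hs, if_pos hw, if_pos ⟨hs, hw⟩]
        · rw [if_pos hs, if_neg hw, if_neg (fun h => hw h.2)]
      · rw [if_neg hs, if_neg (fun h => hs h.1)]
    rw [Finset.sum_congr rfl fun d₀ hd₀ => Finset.sum_congr rfl fun d₁ hd₁ => hconv d₀ hd₀ d₁ hd₁]
    refine hm.trans ?_
    have hlogY : Real.log ((x : ℝ) ^ (1 + θ)) ≤ 2 * Real.log x := by
      rw [Real.log_rpow hx0]; nlinarith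
    have hY0 : 0 ≤ (x : ℝ) ^ (1 + θ) := by positivity
    have hlB₀ : 0 ≤ Real.log B₀ := Real.log_nonneg (by exact_mod_cast hB₀1)
    have hlB₁ : 0 ≤ Real.log B₁ := Real.log_nonneg (by exact_mod_cast hB₁1)
    calc Real.log B₀ * Real.log B₁ * ((x : ℝ) ^ (1 + θ) * (1 + Real.log ((x : ℝ) ^ (1 + θ))))
        ≤ (2 * Real.log x) * (2 * Real.log x) * ((x : ℝ) ^ (1 + θ) * (3 * Real.log x)) := by
          refine mul_le_mul (mul_le_mul hlogB₀ hlogB₁ hlB₁ (by positivity)) ?_ (by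
            have : 0 ≤ Real.log ((x : ℝ) ^ (1 + θ)) := by rw [Real.log_rpow hx0]; positivity
            positivity) (by positivity)
          refine mul_le_mul_of_nonneg_left ?_ hY0
          linarith
      _ = 12 * Real.log x ^ 3 * (x : ℝ) ^ (1 + θ) := by ring
  · -- the final numerics
    have hPQ : (x : ℝ) ^ (1 + θ) ≤ (x : ℝ) ^ (1 - c) * (x : ℝ) ^ (2 * c) := by
      calc (x : ℝ) ^ (1 + θ) = (x : ℝ) ^ (1 + θ - 2 * c) * (x : ℝ) ^ (2 * c) := by
            rw [← Real.rpow_add hx0]; ring_nf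
        _ ≤ (x : ℝ) ^ (1 - c) * (x : ℝ) ^ (2 * c) := by
            refine mul_le_mul_of_nonneg_right ?_ (by positivity)
            exact Real.rpow_le_rpow_of_exponent_le hx1 (by linarith)
    have hV1R : (1 : ℝ) ≤ ⌊(x : ℝ) ^ (2 * c)⌋₊ := by exact_mod_cast hV1
    exact psi_numerics hL1 hV1R hKw0 (by positivity) (by positivity) hlogV hlog2V hV3 hPQ hEdef


end Summit.Parity.BatemanHorn.Theorems.PairWindow
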